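import Literature.Probability.RandomPlanarGeometry.SAWBendingEnergyEndpoint
import Literature.Probability.RandomPlanarGeometry.SAWBendingBlockRenewal
import Mathlib.NumberTheory.Real.GoldenRatio
import Mathlib.Analysis.Subadditive
import HarnessLib

/-!
# The all-turn growth constant: `√2 ≤ μ_AT ≤ φ` (lane «STIFF-∞», part 2)

Topic `Literature/Probability/RandomPlanarGeometry` (continues `SAWBendingEnergyEndpoint.lean` — `allTurnWords`,
`Zd.allTurnCount`, `Zd.logMuAT`, the endpoint statements — and `SAWBendingBlockRenewal.lean` — `IsSAW.ne_add_two`,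
`Step.eq_add_one_or_eq_add_three`, `Step.vec_add_two`).

Statement (a-idea-2 gen 8, `Sketch_v7_add4.lean` e4876707b834bb5c, `MuATWindow` / `StiffInfinity`, bodies verbatim
as theorem types): `log √2 ≤ log μ_AT ≤ log φ`, `φ = (1+√5)/2`, and the conjunction «STIFF-∞».
* Lower bound: the words `v₀ 0 v₁ 0 v₂ …` (`vⱼ ∈ {+e₁, −e₁}` free, `0 = +e₀`) are all-turn and self-avoiding
  (the first coordinate after `i` steps is `⌊i/2⌋`), `2^{⌈M/2⌉} ≥ 2^{M/2}` of them.
* Upper bound: consecutive letters of an all-turn self-avoiding word differ by a quarter turn, and three equal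
  consecutive turns close a unit square; hence the Fibonacci recursion `a(M+2) ≤ a(M+1) + a(M)` (`M ≥ 2`; exact
  through `M + 2 = 11`, strict from `12` on) and `a(M) ≤ 16 φ^M`.
* (v) `a(n+m) ≤ a(n) a(m)` and Fekete: `log a(N)/N → log μ_AT` (`tendsto_log_allTurnCount_div`), the form in which
  Kesten–Kraft lower bounds on subsequences transfer to the infimum `logMuAT`.

Identification (lit-2 g9): an all-turn self-avoiding walk on `ℤ²` is exactly a self-avoiding walk on the `L`-lattice
("at each step it can only turn right or left"), so `μ_AT = μ_L`, the `L`-lattice connective constant, with the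
printed series estimate `μ_L = 1.5657(15)`; the kernel window here is `√2 = 1.414… ≤ μ_L ≤ φ = 1.618…`.
[cite: MadrasSlade1993, §1.2; Malakis1975; Kennedy2018ManhattanSLE6, p. 4; JensenGuttmann1998, Table 1;
JansevanRensburg2015, §5.3.1 (paragraph before Theorem 5.46)]
-/

noncomputable section

open Finset Filter Topology
open scoped BigOperators
open Literature.Probability.LatticeModels

namespace Literature.Probability.RandomPlanarGeometry.SAW

/-! ### All-turn words: a criterion -/

/-- If all consecutive letters differ, the word turns at every internal vertex. [cite: MadrasSlade1993, §1.1] -/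
theorem wturns_eq_of_consec_ne : ∀ (w : List Step),
    (∀ (i : ℕ) (h : i + 1 < w.length), w[i] ≠ w[i + 1]) → wturns w = w.length - 1
  | [], _ => rfl
  | [a], _ => rfl
  | a :: b :: w, h => by
    have hab : a ≠ b := h 0 (by simp)
    have ih := wturns_eq_of_consec_ne (b :: w) fun i hi => h (i + 1) (by simpa using hi)
    rw [wturns_cons_cons, if_neg hab, ih]
    simp only [List.length_cons]
    omega

/-! ### Lower bound: the free-orientation family -/

/-- The word `v₀ 0 v₁ 0 …` of length `M`: at even positions a vertical letter chosen by `σ` (`true ↦ 1 = +e₁`,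
`false ↦ 3 = −e₁`), at odd positions the letter `0 = +e₀`. [cite: MadrasSlade1993, §1.2] -/
def freeWord (M : ℕ) (σ : ℕ → Bool) : List Step :=
  List.ofFn fun i : Fin M => if i.val % 2 = 0 then (if σ (i.val / 2) then (1 : Step) else 3) else 0

/-- Length of `freeWord`. [cite: MadrasSlade1993, §1.2] -/
@[simp] theorem length_freeWord (M : ℕ) (σ : ℕ → Bool) : (freeWord M σ).length = M := by
  simp [freeWord]

/-- Letters of `freeWord`. [cite: MadrasSlade1993, §1.2] -/
theorem getElem_freeWord (M : ℕ) (σ : ℕ → Bool) {i : ℕ} (hi : i < (freeWord M σ).length) :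
    (freeWord M σ)[i] = if i % 2 = 0 then (if σ (i / 2) then (1 : Step) else 3) else 0 := by
  simp [freeWord, List.getElem_ofFn]

/-- The first coordinate along `freeWord` after `i` steps is `⌊i/2⌋`. [cite: MadrasSlade1993, §1.2] -/
theorem traj_freeWord_apply_zero (M : ℕ) (σ : ℕ → Bool) :
    ∀ i, i ≤ M → traj (freeWord M σ) i 0 = ((i / 2 : ℕ) : ℤ) := by
  intro i
  induction i with
  | zero => intro; simp
  | succ i ih =>
    intro hi
    have hlt : i < (freeWord M σ).length := by simp; omega
    rw [traj_succ _ hlt, Pi.add_apply, ih (by omega), getElem_freeWord, Step.vec_apply_zero]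
    rcases Nat.mod_two_eq_zero_or_one i with h | h
    · rw [if_pos h]
      have : (i + 1) / 2 = i / 2 := by omega
      rw [this]
      split_ifs <;> simp [Step.dx]
    · rw [if_neg (by omega)]
      have : (i + 1) / 2 = i / 2 + 1 := by omega
      rw [this]
      simp [Step.dx]

/-- `freeWord` is self-avoiding. [cite: MadrasSlade1993, §1.2] -/
theorem isSAW_freeWord (M : ℕ) (σ : ℕ → Bool) : IsSAW (freeWord M σ) := by
  rw [isSAW_iff_injOn]
  have key : ∀ i j, i ≤ M → j ≤ M → i < j → traj (freeWord M σ) i ≠ traj (freeWord M σ) j := by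
    intro i j hi hj hij heq
    have h1 := traj_freeWord_apply_zero M σ i hi
    have h2 := traj_freeWord_apply_zero M σ j hj
    have h3 : ((i / 2 : ℕ) : ℤ) = ((j / 2 : ℕ) : ℤ) := by rw [← h1, ← h2, heq]
    have h4 : j = i + 1 := by
      have : (i / 2 : ℕ) = j / 2 := by exact_mod_cast h3
      omega
    subst h4
    exact (adj_traj_succ (freeWord M σ) (by simp; omega)).ne heq
  intro i hi j hj hij
  simp only [Set.mem_setOf_eq, length_freeWord] at hi hj
  rcases lt_trichotomy i j with h | h | h
  · exact absurd hij (key i j hi hj h)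
  · exact h
  · exact absurd hij.symm (key j i hj hi h)

/-- `freeWord` turns at every internal vertex. [cite: MadrasSlade1993, §1.2] -/
theorem wturns_freeWord (M : ℕ) (σ : ℕ → Bool) : wturns (freeWord M σ) = M - 1 := by
  have h := wturns_eq_of_consec_ne (freeWord M σ) fun i hi => ?_
  · rwa [length_freeWord] at h
  rw [getElem_freeWord, getElem_freeWord]
  rcases Nat.mod_two_eq_zero_or_one i with h | h
  · rw [if_pos h, if_neg (show ¬ ((i + 1) % 2 = 0) by omega)]
    split_ifs <;> decide
  · rw [if_neg (show ¬ (i % 2 = 0) by omega), if_pos (show (i + 1) % 2 = 0 by omega)]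
    split_ifs <;> decide

/-- `freeWord M σ` is an all-turn self-avoiding word. [cite: MadrasSlade1993, §1.2] -/
theorem freeWord_mem_allTurnWords (M : ℕ) (σ : ℕ → Bool) : freeWord M σ ∈ allTurnWords M :=
  mem_allTurnWords.2 ⟨length_freeWord M σ, isSAW_freeWord M σ, wturns_freeWord M σ⟩

/-- **`a(M) ≥ 2^{⌈M/2⌉}`**: the letters at even positions are free. [cite: MadrasSlade1993, §1.2] -/
theorem two_pow_le_card_allTurnWords (M : ℕ) : 2 ^ ((M + 1) / 2) ≤ (allTurnWords M).card := by
  classical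
  set K := (M + 1) / 2 with hK
  let F : (Fin K → Bool) → List Step := fun f => freeWord M fun j => if h : j < K then f ⟨j, h⟩ else false
  have hinj : Function.Injective F := by
    intro f g hfg
    funext ⟨j, hj⟩
    have h2j : 2 * j < M := by omega
    have e1 : (F f)[2 * j]'(by simp [F]; omega) = (F g)[2 * j]'(by simp [F]; omega) := by simp [hfg]
    simp only [F, getElem_freeWord, Nat.mul_mod_right, if_true, Nat.mul_div_right _ (by norm_num : 0 < 2),
      dif_pos hj] at e1
    revert e1
    cases f ⟨j, hj⟩ <;> cases g ⟨j, hj⟩ <;> decide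
  calc 2 ^ ((M + 1) / 2) = (Finset.univ : Finset (Fin K → Bool)).card := by simp [hK]
    _ = ((Finset.univ : Finset (Fin K → Bool)).image F).card := (Finset.card_image_of_injective _ hinj).symm
    _ ≤ (allTurnWords M).card := Finset.card_le_card fun w hw => by
        obtain ⟨f, -, rfl⟩ := Finset.mem_image.1 hw
        exact freeWord_mem_allTurnWords M _


/-! ### Upper bound: the Fibonacci recursion `a(M+2) ≤ a(M+1) + a(M)` -/

/-- In an all-turn word all consecutive letters differ. [cite: MadrasSlade1993, §1.1] -/
theorem consec_ne_of_wturns_eq : ∀ (w : List Step), wturns w = w.length - 1 →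
    ∀ (i : ℕ) (h : i + 1 < w.length), w[i] ≠ w[i + 1]
  | [], _, i, h => by simp at h
  | [a], _, i, h => by simp at h
  | a :: b :: w, hw, i, h => by
    have hle := wturns_le_length_sub_one (b :: w)
    simp only [wturns_cons_cons, List.length_cons] at hw hle
    have hab : a ≠ b := by
      by_contra hab
      rw [if_pos hab] at hw
      omega
    rw [if_neg hab] at hw
    rcases i with _ | i
    · simpa using hab
    · have ih := consec_ne_of_wturns_eq (b :: w) (by simp only [List.length_cons]; omega) i (by simpa using h)
      simpa using ih

/-- Consecutive letters of an all-turn self-avoiding word differ by a quarter turn: `w[i+1] = w[i] ± 1`.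
[cite: MadrasSlade1993, §1.1] -/
theorem getElem_succ_of_mem_allTurnWords {M : ℕ} {w : List Step} (hw : w ∈ allTurnWords M) {i : ℕ}
    (hi : i + 1 < w.length) : w[i + 1] = w[i] + 1 ∨ w[i + 1] = w[i] + 3 := by
  obtain ⟨hl, hs, ht⟩ := mem_allTurnWords.1 hw
  have h1 : w[i + 1] ≠ w[i] := (consec_ne_of_wturns_eq w (by rw [hl]; exact ht) i hi).symm
  have h2 : w[i + 1] ≠ w[i] + 2 := by
    have e : w = w.take i ++ w[i] :: w[i + 1] :: w.drop (i + 2) := by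
      conv_lhs => rw [← List.take_append_drop i w, List.drop_eq_getElem_cons (by omega : i < w.length),
        List.drop_eq_getElem_cons (by omega : i + 1 < w.length)]
    have hs' := hs
    rw [e] at hs'
    exact IsSAW.ne_add_two hs'
  exact Step.eq_add_one_or_eq_add_three h1 h2

/-- Prefixes of all-turn self-avoiding words are all-turn self-avoiding words. [cite: MadrasSlade1993, §1.1] -/
theorem take_mem_allTurnWords {M : ℕ} {w : List Step} (hw : w ∈ allTurnWords M) {k : ℕ} (hk : k ≤ M) :
    w.take k ∈ allTurnWords k := by
  obtain ⟨hl, hs, ht⟩ := mem_allTurnWords.1 hw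
  have hlen : (w.take k).length = k := by simp [hl, hk]
  refine mem_allTurnWords.2 ⟨hlen, hs.take k, ?_⟩
  have h := wturns_eq_of_consec_ne (w.take k) fun i hi => ?_
  · rwa [hlen] at h
  rw [List.getElem_take, List.getElem_take]
  exact consec_ne_of_wturns_eq w (by rw [hl]; exact ht) i (by rw [hlen] at hi; omega)

/-- `a + ε + ε = a + 2` for a quarter turn `ε`. [cite: MadrasSlade1993, §1.1] -/
theorem Step.add_twice (a : Step) {ε : Step} (hε : ε = 1 ∨ ε = 3) : a + ε + ε = a + 2 := by
  rcases hε with rfl | rfl <;> revert a <;> decide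

/-- **No unit square**: three equal consecutive turns are impossible in a self-avoiding word
(`a, a+ε, a+2ε, a+3ε` sum to zero). [cite: MadrasSlade1993, §1.1] -/
theorem not_three_turns {w : List Step} (hs : IsSAW w) {i j k l : ℕ} (hj : j = i + 1) (hk : k = i + 2)
    (hl : l = i + 3) (hl' : l < w.length) {ε : Step} (hε : ε = 1 ∨ ε = 3)
    (h1 : w[j]'(by omega) = w[i]'(by omega) + ε) (h2 : w[k]'(by omega) = w[j]'(by omega) + ε)
    (h3 : w[l] = w[k]'(by omega) + ε) : False := by
  subst hj hk hl
  rw [isSAW_iff_injOn] at hs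
  have hsum : Step.vec w[i] + Step.vec w[i + 1] + Step.vec w[i + 2] + Step.vec w[i + 3] = 0 := by
    rw [h3, h2, h1, Step.add_twice _ hε, show w[i] + 2 + ε = w[i] + ε + 2 from add_right_comm _ _ _,
      Step.vec_add_two, Step.vec_add_two]
    abel
  have key : traj w (i + 4) = traj w i := by
    rw [traj_succ w (by omega : i + 3 < w.length), traj_succ w (by omega : i + 2 < w.length),
      traj_succ w (by omega : i + 1 < w.length), traj_succ w (by omega : i < w.length)]
    rw [add_assoc, add_assoc, add_assoc, ← add_assoc (Step.vec w[i + 1]), ← add_assoc (Step.vec w[i]),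
      ← add_assoc (Step.vec w[i]), hsum, add_zero]
  have := hs (show i + 4 ∈ {j | j ≤ w.length} by simp; omega) (show i ∈ {j | j ≤ w.length} by simp; omega) key
  omega

/-- Two candidates `x, x' ∈ {c+1, c+3}` avoiding the same `e ∈ {c+1, c+3}` coincide. [cite: MadrasSlade1993, §1.1] -/
theorem Step.eq_of_quarter_turn_ne {c x x' e : Step} (hx : x = c + 1 ∨ x = c + 3) (hx' : x' = c + 1 ∨ x' = c + 3)
    (he : e = c + 1 ∨ e = c + 3) (h1 : x ≠ e) (h2 : x' ≠ e) : x = x' := by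
  revert c x x' e; decide

/-- **The Fibonacci recursion `a(M+2) ≤ a(M+1) + a(M)`** (`M ≥ 2`): split by whether the last turn repeats the
previous one; if not, the word is determined by its first `M+1` letters; if so, the turn before differs (no unit
square) and the word is determined by its first `M` letters. [cite: MadrasSlade1993, §1.2] -/
theorem card_allTurnWords_add_two_le (M : ℕ) (hM : 2 ≤ M) :
    (allTurnWords (M + 2)).card ≤ (allTurnWords (M + 1)).card + (allTurnWords M).card := by
  classical
  -- `P w`: the last turn repeats the previous one, i.e. `w[M+1] - w[M] = w[M] - w[M-1]`
  set P : List Step → Prop := fun w =>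
    ∃ (h : M + 1 < w.length), ∃ ε : Step, (ε = 1 ∨ ε = 3) ∧ w[M] = w[M - 1] + ε ∧ w[M + 1] = w[M] + ε with hP
  rw [← Finset.card_filter_add_card_filter_not (p := P), add_comm]
  refine add_le_add ?_ ?_
  · -- last turn does NOT repeat: `take (M+1)` is injective
    refine Finset.card_le_card_of_injOn (fun w => w.take (M + 1)) (fun w hw => ?_) ?_
    · exact take_mem_allTurnWords (Finset.mem_filter.1 hw).1 (by omega)
    · intro w hw w' hw' heq
      rw [Finset.mem_coe, Finset.mem_filter] at hw hw'
      obtain ⟨hwA, hwP⟩ := hw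
      obtain ⟨hw'A, hw'P⟩ := hw'
      have hl : w.length = M + 2 := (mem_allTurnWords.1 hwA).1
      have hl' : w'.length = M + 2 := (mem_allTurnWords.1 hw'A).1
      have hpre : ∀ j (hj : j < M + 1), w[j]'(by omega) = w'[j]'(by omega) := fun j hj => by
        have := congrArg (fun l => l[j]?) heq
        simpa [List.getElem?_take, hj, List.getElem?_eq_getElem (show j < w.length by omega),
          List.getElem?_eq_getElem (show j < w'.length by omega)] using this
      -- the candidate last letters and the excluded one
      obtain ⟨ε, hε, hεeq⟩ : ∃ ε : Step, (ε = 1 ∨ ε = 3) ∧ w[M]'(by omega) = w[M - 1]'(by omega) + ε := by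
        have h := getElem_succ_of_mem_allTurnWords hwA (i := M - 1) (by omega)
        have e : M - 1 + 1 = M := by omega
        simp only [e] at h
        rcases h with h | h
        · exact ⟨1, Or.inl rfl, h⟩
        · exact ⟨3, Or.inr rfl, h⟩
      have hx := getElem_succ_of_mem_allTurnWords hwA (i := M) (by omega)
      have hx' := getElem_succ_of_mem_allTurnWords hw'A (i := M) (by omega)
      have hne : w[M + 1]'(by omega) ≠ w[M]'(by omega) + ε := fun h =>
        hwP ⟨by omega, ε, hε, hεeq, h⟩
      have hne' : w'[M + 1]'(by omega) ≠ w[M]'(by omega) + ε := fun h => by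
        refine hw'P ⟨by omega, ε, hε, ?_, ?_⟩
        · rw [← hpre M (by omega), ← hpre (M - 1) (by omega)]; exact hεeq
        · rw [← hpre M (by omega)]; exact h
      rw [← hpre M (by omega)] at hx'
      have hlast := Step.eq_of_quarter_turn_ne hx hx' (by rcases hε with rfl | rfl <;> simp) hne hne'
      refine List.ext_getElem (by rw [hl, hl']) fun j hj hj' => ?_
      rcases Nat.lt_or_ge j (M + 1) with h | h
      · exact hpre j h
      · have : j = M + 1 := by omega
        subst this; exact hlast
  · -- last turn repeats: then the turn before differs, and `take M` is injective
    refine Finset.card_le_card_of_injOn (fun w => w.take M) (fun w hw => ?_) ?_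
    · exact take_mem_allTurnWords (Finset.mem_filter.1 hw).1 (by omega)
    · intro w hw w' hw' heq
      rw [Finset.mem_coe, Finset.mem_filter] at hw hw'
      obtain ⟨hwA, ⟨_, ε, hε, hε1, hε2⟩⟩ := hw
      obtain ⟨hw'A, ⟨_, ε', hε', hε1', hε2'⟩⟩ := hw'
      have hl : w.length = M + 2 := (mem_allTurnWords.1 hwA).1
      have hl' : w'.length = M + 2 := (mem_allTurnWords.1 hw'A).1
      have hpre : ∀ j (hj : j < M), w[j]'(by omega) = w'[j]'(by omega) := fun j hj => by
        have := congrArg (fun l => l[j]?) heq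
        simpa [List.getElem?_take, hj, List.getElem?_eq_getElem (show j < w.length by omega),
          List.getElem?_eq_getElem (show j < w'.length by omega)] using this
      -- the turn at `M-2 → M-1 → M` differs from `ε` (no unit square), for both words
      obtain ⟨δ, hδ, hδeq⟩ : ∃ δ : Step, (δ = 1 ∨ δ = 3) ∧ w[M - 1]'(by omega) = w[M - 2]'(by omega) + δ := by
        have h := getElem_succ_of_mem_allTurnWords hwA (i := M - 2) (by omega)
        have e : M - 2 + 1 = M - 1 := by omega
        simp only [e] at h
        rcases h with h | h
        · exact ⟨1, Or.inl rfl, h⟩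
        · exact ⟨3, Or.inr rfl, h⟩
      have hsq : w[M]'(by omega) ≠ w[M - 1]'(by omega) + δ := by
        intro h
        have hεδ : ε = δ := add_left_cancel (hε1.symm.trans h)
        subst hεδ
        exact not_three_turns (mem_allTurnWords.1 hwA).2.1 (i := M - 2) (j := M - 1) (k := M) (l := M + 1)
          (by omega) (by omega) (by omega) (by omega) hε hδeq h hε2
      have hsq' : w'[M]'(by omega) ≠ w[M - 1]'(by omega) + δ := by
        intro h
        have h' : w'[M]'(by omega) = w'[M - 1]'(by omega) + δ := by
          rw [← hpre (M - 1) (by omega)]; exact h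
        have hεδ : ε' = δ := add_left_cancel (hε1'.symm.trans h')
        subst hεδ
        have hδeq' : w'[M - 1]'(by omega) = w'[M - 2]'(by omega) + ε' := by
          rw [← hpre (M - 1) (by omega), ← hpre (M - 2) (by omega)]; exact hδeq
        exact not_three_turns (mem_allTurnWords.1 hw'A).2.1 (i := M - 2) (j := M - 1) (k := M) (l := M + 1)
          (by omega) (by omega) (by omega) (by omega) hε' hδeq' h' hε2'
      have hM_eq : w[M]'(by omega) = w'[M]'(by omega) := by
        have hx := getElem_succ_of_mem_allTurnWords hwA (i := M - 1) (by omega)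
        have hx' := getElem_succ_of_mem_allTurnWords hw'A (i := M - 1) (by omega)
        have e : M - 1 + 1 = M := by omega
        simp only [e] at hx hx'
        rw [← hpre (M - 1) (by omega)] at hx'
        exact Step.eq_of_quarter_turn_ne hx hx' (by rcases hδ with rfl | rfl <;> simp) hsq hsq'
      have hM1_eq : w[M + 1]'(by omega) = w'[M + 1]'(by omega) := by
        rw [hε2, hε2']
        have : ε = ε' := by
          have h2 := hε1'
          rw [← hM_eq, ← hpre (M - 1) (by omega), hε1] at h2
          exact add_left_cancel h2
        rw [this, hM_eq]
      refine List.ext_getElem (by rw [hl, hl']) fun j hj hj' => ?_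
      rcases Nat.lt_or_ge j M with h | h
      · exact hpre j h
      · rcases (show j = M ∨ j = M + 1 by omega) with rfl | rfl
        · exact hM_eq
        · exact hM1_eq

/-- `a(M) ≤ 4^M`. [cite: MadrasSlade1993, §1.1] -/
theorem card_allTurnWords_le_pow (M : ℕ) : (allTurnWords M).card ≤ 4 ^ M :=
  le_trans (Finset.card_le_card (fun w hw => by
    rw [mem_allTurnWords] at hw
    exact mem_words.2 hw.1)) (card_words M).le

/-- **`a(M) ≤ 16 φ^M`** by the Fibonacci recursion (`φ² = φ + 1`) from the trivial bounds for `M ≤ 3`.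
[cite: MadrasSlade1993, §1.2] -/
theorem card_allTurnWords_le_goldenRatio_pow : ∀ M : ℕ, ((allTurnWords M).card : ℝ) ≤ 16 * Real.goldenRatio ^ M
  | 0 => by
    have h := card_allTurnWords_le_pow 0
    have : ((allTurnWords 0).card : ℝ) ≤ 1 := by exact_mod_cast h
    simp; linarith
  | 1 => by
    have h := card_allTurnWords_le_pow 1
    have h' : ((allTurnWords 1).card : ℝ) ≤ 4 := by exact_mod_cast h
    have := Real.one_lt_goldenRatio
    rw [pow_one]; linarith
  | 2 => by
    have h := card_allTurnWords_le_pow 2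
    have h' : ((allTurnWords 2).card : ℝ) ≤ 16 := by exact_mod_cast h
    have h1 := Real.one_lt_goldenRatio
    nlinarith
  | 3 => by
    have h := card_allTurnWords_le_pow 3
    have h' : ((allTurnWords 3).card : ℝ) ≤ 64 := by exact_mod_cast h
    have h1 := Real.one_lt_goldenRatio
    have h2 : Real.goldenRatio ^ 3 = 2 * Real.goldenRatio + 1 := by
      have := Real.goldenRatio_sq
      calc Real.goldenRatio ^ 3 = Real.goldenRatio * Real.goldenRatio ^ 2 := by ring
        _ = Real.goldenRatio * (Real.goldenRatio + 1) := by rw [this]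
        _ = Real.goldenRatio ^ 2 + Real.goldenRatio := by ring
        _ = 2 * Real.goldenRatio + 1 := by rw [this]; ring
    rw [h2]
    have h3 : (1.6 : ℝ) < Real.goldenRatio := by
      rw [Real.goldenRatio]
      have : (2.2 : ℝ) < Real.sqrt 5 := by
        rw [show (2.2 : ℝ) = Real.sqrt (2.2 ^ 2) by rw [Real.sqrt_sq (by norm_num)]]
        exact Real.sqrt_lt_sqrt (by norm_num) (by norm_num)
      linarith
    linarith
  | M + 4 => by
    have h := card_allTurnWords_add_two_le (M + 2) (by omega)
    have h' : ((allTurnWords (M + 4)).card : ℝ) ≤ (allTurnWords (M + 3)).card + (allTurnWords (M + 2)).card := by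
      exact_mod_cast h
    have h3 := card_allTurnWords_le_goldenRatio_pow (M + 3)
    have h2 := card_allTurnWords_le_goldenRatio_pow (M + 2)
    have e : (16 : ℝ) * Real.goldenRatio ^ (M + 4) = 16 * Real.goldenRatio ^ (M + 3) + 16 * Real.goldenRatio ^ (M + 2) := by
      have := Real.goldenRatio_sq
      calc (16 : ℝ) * Real.goldenRatio ^ (M + 4) = 16 * Real.goldenRatio ^ (M + 2) * Real.goldenRatio ^ 2 := by ring
        _ = 16 * Real.goldenRatio ^ (M + 2) * (Real.goldenRatio + 1) := by rw [this]
        _ = _ := by ring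
    linarith


/-! ### (v) Submultiplicativity `a(n+m) ≤ a(n) a(m)` -/

/-- Suffixes of all-turn self-avoiding words are all-turn self-avoiding words. [cite: MadrasSlade1993, §1.2] -/
theorem drop_mem_allTurnWords {M : ℕ} {w : List Step} (hw : w ∈ allTurnWords M) (k : ℕ) :
    w.drop k ∈ allTurnWords (M - k) := by
  obtain ⟨hl, hs, ht⟩ := mem_allTurnWords.1 hw
  have hlen : (w.drop k).length = M - k := by simp [hl]
  refine mem_allTurnWords.2 ⟨hlen, hs.drop k, ?_⟩
  have h := wturns_eq_of_consec_ne (w.drop k) fun i hi => ?_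
  · rwa [hlen] at h
  rw [List.getElem_drop, List.getElem_drop]
  have := consec_ne_of_wturns_eq w (by rw [hl]; exact ht) (k + i) (by rw [hlen] at hi; rw [hl]; omega)
  simpa [Nat.add_assoc] using this

/-- **«STIFF-∞» (v), `AllTurnSubmult`**: `a(n+m) ≤ a(n)·a(m)` — splitting an all-turn self-avoiding word after `n`
letters gives two (so `μ_AT = lim a(N)^{1/N}` by Fekete). [cite: MadrasSlade1993, §1.2, Lemma 1.2.2] -/
theorem card_allTurnWords_add_le (n m : ℕ) :
    (allTurnWords (n + m)).card ≤ (allTurnWords n).card * (allTurnWords m).card := by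
  classical
  rw [← Finset.card_product]
  refine Finset.card_le_card_of_injOn (fun w => (w.take n, w.drop n)) (fun w hw => ?_) ?_
  · rw [Finset.mem_coe] at hw
    rw [Finset.mem_coe, Finset.mem_product]
    refine ⟨take_mem_allTurnWords hw (by omega), ?_⟩
    have := drop_mem_allTurnWords hw n
    rwa [show n + m - n = m by omega] at this
  · intro w _ w' _ h
    simp only [Prod.mk.injEq] at h
    rw [← List.take_append_drop n w, ← List.take_append_drop n w', h.1, h.2]

end Literature.Probability.RandomPlanarGeometry.SAW

namespace Literature.Probability.RandomPlanarGeometry.SAW.Zd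

open Literature.Probability.RandomPlanarGeometry.SAW

/-- **Lower half of `MuATWindow`: `log √2 ≤ log μ_AT`** (`a(M) ≥ 2^{M/2}`). [cite: MadrasSlade1993, §1.2] -/
theorem log_sqrt_two_le_logMuAT : Real.log (Real.sqrt 2) ≤ logMuAT := by
  refine le_ciInf fun N => ?_
  have hK := two_pow_le_card_allTurnWords (N + 1)
  rw [← allTurnCount_eq_card_allTurnWords] at hK
  have ha : (0 : ℝ) < allTurnCount (N + 1) := by exact_mod_cast one_le_allTurnCount (N + 1)
  have h1 : ((2 : ℝ) ^ ((N + 2) / 2 : ℕ)) ≤ (allTurnCount (N + 1) : ℝ) := by exact_mod_cast hK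
  have h2 : (((N + 2) / 2 : ℕ) : ℝ) * Real.log 2 ≤ Real.log (allTurnCount (N + 1)) := by
    have := Real.log_le_log (by positivity) h1
    rwa [Real.log_pow] at this
  have h3 : ((N : ℝ) + 1) / 2 ≤ (((N + 2) / 2 : ℕ) : ℝ) := by
    have : N + 1 ≤ 2 * ((N + 2) / 2) := by omega
    have : ((N : ℝ) + 1) ≤ 2 * (((N + 2) / 2 : ℕ) : ℝ) := by exact_mod_cast this
    linarith
  rw [Real.log_sqrt (by norm_num : (0 : ℝ) ≤ 2), le_div_iff₀ (by positivity : (0 : ℝ) < (N : ℝ) + 1)]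
  have hl2 : 0 ≤ Real.log 2 := Real.log_nonneg (by norm_num)
  nlinarith

/-- **Upper half of `MuATWindow`: `log μ_AT ≤ log φ`** (`a(M) ≤ 16 φ^M` for every `M`). [cite: MadrasSlade1993, §1.2] -/
theorem logMuAT_le_log_goldenRatio : logMuAT ≤ Real.log ((1 + Real.sqrt 5) / 2) := by
  have hφ : Real.goldenRatio = (1 + Real.sqrt 5) / 2 := rfl
  rw [← hφ]
  have hφ1 := Real.one_lt_goldenRatio
  refine le_of_forall_pos_lt_add fun ε hε => ?_
  -- choose `N` with `log 16 / (N+1) < ε`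
  obtain ⟨N, hN⟩ := exists_nat_gt (Real.log 16 / ε)
  have hN1 : Real.log 16 / ((N : ℝ) + 1) < ε := by
    rw [div_lt_iff₀ (by positivity)]
    rw [div_lt_iff₀ hε] at hN
    nlinarith
  have ha : (0 : ℝ) < allTurnCount (N + 1) := by exact_mod_cast one_le_allTurnCount (N + 1)
  have h1 := logMuAT_le N
  have h2 : Real.log (allTurnCount (N + 1)) ≤ Real.log 16 + ((N : ℝ) + 1) * Real.log Real.goldenRatio := by
    have h := card_allTurnWords_le_goldenRatio_pow (N + 1)
    rw [← allTurnCount_eq_card_allTurnWords] at h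
    have := Real.log_le_log ha h
    rw [Real.log_mul (by norm_num) (by positivity), Real.log_pow] at this
    push_cast at this
    exact this
  have h3 : Real.log (allTurnCount (N + 1)) / ((N : ℝ) + 1) ≤
      Real.log 16 / ((N : ℝ) + 1) + Real.log Real.goldenRatio := by
    rw [div_add' _ _ _ (by positivity : ((N : ℝ) + 1) ≠ 0), div_le_div_iff_of_pos_right (by positivity)]
    linarith
  linarith

/-- **«STIFF-∞» (iv), `MuATWindow`**: `log √2 ≤ log μ_AT ≤ log φ`. [cite: MadrasSlade1993, §1.2] -/
theorem muATWindow : Real.log (Real.sqrt 2) ≤ logMuAT ∧ logMuAT ≤ Real.log ((1 + Real.sqrt 5) / 2) :=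
  ⟨log_sqrt_two_le_logMuAT, logMuAT_le_log_goldenRatio⟩

/-- **«STIFF-∞»** (a-idea-2's `StiffInfinity`, body verbatim): the four endpoint statements together.
[cite: MadrasSlade1993, §1.2; JansevanRensburg2015, §5.3.1 (paragraph before Theorem 5.46)] -/
theorem stiffInfinity :
    (∀ t : ℝ, 1 ≤ t → Real.log t + logMuAT ≤ Zd.bendFE t) ∧
      AntitoneOn (fun t : ℝ => Zd.bendFE t - Real.log t) (Set.Ici 1) ∧
      Tendsto (fun t : ℝ => Zd.bendFE t - Real.log t) atTop (𝓝 logMuAT) ∧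
      (Real.log (Real.sqrt 2) ≤ logMuAT ∧ logMuAT ≤ Real.log ((1 + Real.sqrt 5) / 2)) :=
  ⟨endpointLower, endpointAntitone, endpointLimit, muATWindow⟩

/-- **«STIFF-∞» (v)** on the walk counts: `a(n+m) ≤ a(n) a(m)` (a-idea-2's `AllTurnSubmult`, body verbatim).
[cite: MadrasSlade1993, §1.2, Lemma 1.2.2] -/
theorem allTurnSubmult : ∀ n m : ℕ, allTurnCount (n + m) ≤ allTurnCount n * allTurnCount m := fun n m => by
  rw [allTurnCount_eq_card_allTurnWords, allTurnCount_eq_card_allTurnWords, allTurnCount_eq_card_allTurnWords]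
  exact card_allTurnWords_add_le n m

/-- `N ↦ log a(N)` is subadditive. [cite: MadrasSlade1993, §1.2, Lemma 1.2.2] -/
theorem subadditive_log_allTurnCount : Subadditive fun n : ℕ => Real.log (allTurnCount n) := by
  intro m n
  have hm : (0 : ℝ) < allTurnCount m := by exact_mod_cast one_le_allTurnCount m
  have hn : (0 : ℝ) < allTurnCount n := by exact_mod_cast one_le_allTurnCount n
  have hmn : (0 : ℝ) < allTurnCount (m + n) := by exact_mod_cast one_le_allTurnCount (m + n)
  have h := allTurnSubmult m n
  have h' : (allTurnCount (m + n) : ℝ) ≤ (allTurnCount m : ℝ) * allTurnCount n := by exact_mod_cast h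
  have := Real.log_le_log hmn h'
  rwa [Real.log_mul hm.ne' hn.ne'] at this

/-- `log μ_AT` is Fekete's limit of the subadditive sequence `log a(N)`. [cite: MadrasSlade1993, §1.2, Lemma 1.2.2] -/
theorem logMuAT_eq_lim : logMuAT = subadditive_log_allTurnCount.lim := by
  rw [Subadditive.lim, logMuAT, iInf]
  congr 1
  ext x
  simp only [Set.mem_range, Set.mem_image, Set.mem_Ici]
  constructor
  · rintro ⟨N, rfl⟩
    exact ⟨N + 1, by omega, by push_cast; rfl⟩
  · rintro ⟨n, hn, rfl⟩
    obtain ⟨N, rfl⟩ : ∃ N, n = N + 1 := ⟨n - 1, by omega⟩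
    exact ⟨N, by push_cast; rfl⟩

/-- **Fekete for the all-turn counts: `log a(N)/N → log μ_AT`** (so `μ_AT = lim a(N)^{1/N}`, and the infimum
`logMuAT` is a limit — the form the Kesten–Kraft lower bounds need). [cite: MadrasSlade1993, §1.2, Lemma 1.2.2] -/
theorem tendsto_log_allTurnCount_div :
    Tendsto (fun n : ℕ => Real.log (allTurnCount n) / n) atTop (𝓝 logMuAT) := by
  rw [logMuAT_eq_lim]
  refine subadditive_log_allTurnCount.tendsto_lim ⟨0, ?_⟩
  rintro _ ⟨n, rfl⟩
  exact div_nonneg (Real.log_natCast_nonneg _) (Nat.cast_nonneg n)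

end Literature.Probability.RandomPlanarGeometry.SAW.Zd

end
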